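import Summits.KontsevichZagierPeriods.KontsevichZagierPeriods.Theorems.RootDecompRelativeModAbsoluteRegFoldingDegOneP01

/-!
# `RegFoldingDegOne` (route `RootDecompRelativeModAbsolute`, support item stmt-KontsevichZagierPeriods-30571) — PROVED · part 2/14

Cell `decomp-kz`, lens 3 (decomp-kz-lens-3 g9): `regFoldingDegOne_holds :
Theses.RootDecompRelativeModAbsolute.RegFoldingDegOne` BY NAME (in part 14/14) — every Kontsevich–Zagier
integral representation on `ℝ²` whose integrand is a quotient `p/q` of `ℚ`-polynomials with `deg_t q ≤ 1`,
`q ≠ 0` on the domain, is equivalent in `KZ.relations` to `[g] + Σᵢ [Uᵢ]`, the `Uᵢ` honest 2-cells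
`[g.domain × (0,1), hᵢ(x) θ^{Mᵢ}/(1 + θ^{eᵢ} κᵢ(x))]` (unfolded REGULARISED log/arctan monomials), with the
fibre integrals matching a.e.  Architecture: §1–§2 regularised terms `RTerm`, `RegFolding d`; §7 a.e.-congruence;
§8 gluing (`FoldsTo`); §9 one-band toolkit; §P analytic core (kernel independence); §10 cylinders; §11 affine band
chart; §13 `RegFolding 1` from a CAD band cover a.e. + vanishing on unbounded bands; last part: the edge to the born
item text and `regFoldingDegOne_holds`.

Source: `HOME/decomp-kz-lens-3/g9/landing/RootDecompRelativeModAbsoluteRegFoldingDegOne.lean` sha256 60038aa44a5f6303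
(4275 l; critic decomp-kz-crit-1 g2 CLEARED/kernel-confirmed 2026-08-30T09:41:19Z, std axioms), split mechanically
into 14 modules ≤ 400 lines by the landing seat decomp-kz-census-1 g7 (contexts re-opened per part; generic docstrings
added where the source had none; parts 1–13 do not import the route file).  No `sorry`; standard axioms.
References: [cite: KontsevichZagier2001, §1.2]; Basu–Pollack–Roy 2006 Def. 5.1 / Cor. 5.7; Bochnak–Coste–Roy 1998 §2.9.
-/

noncomputable section

open Set MeasureTheory Filter Topology
open scoped BigOperators
open Literature.NumberTheory.Transcendental Literature.ModelTheory.ExponentialFields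

namespace Summit.KontsevichZagierPeriods.RootDecompRelativeModAbsolute.Rung30571

namespace RegularisedLogLayer

namespace AECongr

variable {m : ℕ}

/-- **A.e.-congruence**: representations whose zero-extended integrands agree a.e. differ by a
relation. [KZ 2001, §1.2, rule (1); folklore] -/
theorem of_sub_of_mem_relations_of_indicator_ae (r r' : KZ.IntegralRep m)
    (h : ∀ᵐ x, r.domain.indicator r.integrand x = r'.domain.indicator r'.integrand x) :
    KZ.of r - KZ.of r' ∈ KZ.relations := by
  obtain ⟨hE, hEr, h1⟩ := of_sub_of_restrict_support_mem r
  obtain ⟨hE', hEr', h1'⟩ := of_sub_of_restrict_support_mem r'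
  set s := r.restrict _ hE hEr with hs
  set s' := r'.restrict _ hE' hEr' with hs'
  -- the equaliser of the two shrunken representations
  have hAB : IsSemialgebraic ℚ (s.domain ∩ s'.domain) :=
    s.isSemialgebraic_domain.inter s'.isSemialgebraic_domain
  set E : Set (Fin m → ℝ) := {x | x ∈ s.domain ∩ s'.domain ∧ s.integrand x = s'.integrand x}
    with hEdef
  have hEs : IsSemialgebraic ℚ E :=
    isSemialgebraic_sep_eq (s.isSemialgebraicFunOn_integrand.mono inter_subset_left hAB)
      (s'.isSemialgebraicFunOn_integrand.mono inter_subset_right hAB)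
  have hE1 : E ⊆ s.domain := fun x hx => hx.1.1
  have hE2 : E ⊆ s'.domain := fun x hx => hx.1.2
  -- a.e.: a point of `s.domain` (where `f ≠ 0`) lies in `s'.domain` with the same value
  have key : ∀ x, r.domain.indicator r.integrand x = r'.domain.indicator r'.integrand x →
      x ∈ s.domain → x ∈ E := by
    intro x hx hxs
    have hxs' : x ∈ r.domain ∧ r.integrand x ≠ 0 := hxs
    rw [indicator_of_mem hxs'.1] at hx
    by_cases hx' : x ∈ r'.domain
    · rw [indicator_of_mem hx'] at hx
      have hne : r'.integrand x ≠ 0 := hx ▸ hxs'.2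
      exact ⟨⟨hxs, ⟨hx', hne⟩⟩, hx⟩
    · rw [indicator_of_notMem hx'] at hx
      exact absurd hx hxs'.2
  have key' : ∀ x, r.domain.indicator r.integrand x = r'.domain.indicator r'.integrand x →
      x ∈ s'.domain → x ∈ E := by
    intro x hx hxs
    have hxs' : x ∈ r'.domain ∧ r'.integrand x ≠ 0 := hxs
    rw [indicator_of_mem hxs'.1] at hx
    by_cases hx' : x ∈ r.domain
    · rw [indicator_of_mem hx'] at hx
      have hne : r.integrand x ≠ 0 := hx.symm ▸ hxs'.2
      exact ⟨⟨⟨hx', hne⟩, hxs⟩, hx⟩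
    · rw [indicator_of_notMem hx'] at hx
      exact absurd hx.symm hxs'.2
  have hvol1 : volume (s.domain \ E) = 0 := by
    rw [measure_eq_zero_iff_ae_notMem]
    filter_upwards [h] with x hx hxm
    exact hxm.2 (key x hx hxm.1)
  have hvol2 : volume (s'.domain \ E) = 0 := by
    rw [measure_eq_zero_iff_ae_notMem]
    filter_upwards [h] with x hx hxm
    exact hxm.2 (key' x hx hxm.1)
  have h2 := s.of_sub_of_restrict_mem_relations hEs hE1 hvol1
  have h2' := s'.of_sub_of_restrict_mem_relations hEs hE2 hvol2
  have h3 : KZ.of (s.restrict E hEs hE1) - KZ.of (s'.restrict E hEs hE2) ∈ KZ.relations :=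
    KZ.of_sub_of_mem_relations_of_eqOn rfl fun x hx => hx.2
  have e : KZ.of r - KZ.of r' = (KZ.of r - KZ.of s) - (KZ.of r' - KZ.of s') +
      ((KZ.of s - KZ.of (s.restrict E hEs hE1)) - (KZ.of s' - KZ.of (s'.restrict E hEs hE2))) +
      (KZ.of (s.restrict E hEs hE1) - KZ.of (s'.restrict E hEs hE2)) := by abel
  rw [e]
  exact KZ.relations.add_mem (KZ.relations.add_mem (KZ.relations.sub_mem h1 h1')
    (KZ.relations.sub_mem h2 h2')) h3

/-- **The monomial-free case of `RegKernelPairDegOne`** (`k = k' = 0`), PROVED unconditionally: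
a first decided instance of the transcendence piece (BC5-type rung; no logarithms occur). -/
theorem regKernelPairDegOne_zero (g g' : KZ.IntegralRep 1)
    (h : ∀ᵐ x : (Fin 1 → ℝ), g.domain.indicator g.integrand x = g'.domain.indicator g'.integrand x) :
    (KZ.of g + ∑ i : Fin 0, KZ.of ((Fin.elim0 i : KZ.IntegralRep (1 + 1))))
      - (KZ.of g' + ∑ j : Fin 0, KZ.of ((Fin.elim0 j : KZ.IntegralRep (1 + 1)))) ∈ KZ.relations := by
  simpa using of_sub_of_mem_relations_of_indicator_ae g g' h

/-- The same in the structured form: `RegKernelPair` holds for terms without monomials. -/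
theorem regKernelPair_zero (T T' : RTerm 1) (hT : T.Admissible) (hT' : T'.Admissible)
    (hk : T.k = 0) (hk' : T'.k = 0)
    (h : ∀ᵐ x : (Fin 1 → ℝ), T.domain.indicator T.integrand x = T'.domain.indicator T'.integrand x) :
    RTerm.unfold T hT - RTerm.unfold T' hT' ∈ KZ.relations := by
  have hs : ∀ (S : RTerm 1) (hS : S.Admissible), S.k = 0 →
      RTerm.unfold S hS = KZ.of (RTerm.baseRep S hS) ∧ S.integrand = S.h₀ := by
    intro S hS h0
    constructor
    · rw [RTerm.unfold, add_eq_left]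
      exact Finset.sum_eq_zero fun i _ => (Fin.cast h0 i).elim0
    · funext x
      rw [RTerm.integrand, add_eq_left]
      exact Finset.sum_eq_zero fun i _ => (Fin.cast h0 i).elim0
  obtain ⟨e1, f1⟩ := hs T hT hk
  obtain ⟨e2, f2⟩ := hs T' hT' hk'
  rw [e1, e2]
  refine of_sub_of_mem_relations_of_indicator_ae _ _ ?_
  simpa [RTerm.baseRep, f1, f2] using h

end AECongr

/-! ## §8 GLUING (PROVED): regularised folding is LOCAL on the domain

`FoldsTo r T hT` is the conclusion of `RegFolding` for one representation `r` and one admissible term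
`T`.  PROVED here, for every base dimension `b`:
* the GLUED term `T₁.glue T₂` (union of the bases, all data extended by zero) of two admissible terms is
  admissible, its unfolding is the sum of the two unfoldings modulo `KZ.relations`
  (`unfold_glue_sub_mem`), and its zero-extended function is the sum of the two
  (`indicator_integrand_glue`);
* `FoldsTo` passes from a domain split `D = D₁ ∪ D₂` with null overlap and the same integrand to `D`
  (`FoldsTo.glue`), from `E ⊆ D` with `D ∖ E` null to `D` (`FoldsTo.of_restrict`), holds with the empty
  term when `D` is null (`foldsTo_empty_of_null`), hence from any finite `ℚ`-semialgebraic cover of `D`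
  up to a null set with pairwise-null overlaps (`foldsTo_of_cover`);
* `RegFolding d` is literally its `FoldsTo` form (`regFolding_iff_foldsTo`).
USE (items 30571 / 30573): after the tree's cylindrical decomposition
(`IsSemialgebraic.exists_cylindricalDecomposition_holds`, adapted to `D` and the discriminant data) the
prover folds ONE band over ONE cell at a time and glues with `foldsTo_of_cover`. -/

section GlueTransport

variable {b : ℕ}

/-- A.e. on `ℝᵇ⁺¹` ⇒ for a.e. `x`, a.e. in `t`, along `Fin.snoc`. [folklore] -/
theorem ae_ae_snoc {p : (Fin (b + 1) → ℝ) → Prop} (h : ∀ᵐ z, p z) :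
    ∀ᵐ x : (Fin b → ℝ), ∀ᵐ t : ℝ, p (Fin.snoc x t) := by
  set e : (Fin (b + 1) → ℝ) ≃ᵐ ℝ × (Fin b → ℝ) :=
    MeasurableEquiv.piFinSuccAbove (fun _ => ℝ) (Fin.last b) with he_def
  have he : MeasurePreserving e volume volume :=
    volume_preserving_piFinSuccAbove (fun _ => ℝ) (Fin.last b)
  have he_symm : ∀ p : ℝ × (Fin b → ℝ), e.symm p = Fin.snoc p.2 p.1 := fun p => by
    simp [he_def, MeasurableEquiv.piFinSuccAbove, Fin.snocEquiv]
  have h1 : ∀ᵐ q : ℝ × (Fin b → ℝ) ∂((volume : Measure ℝ).prod (volume : Measure (Fin b → ℝ))),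
      p (e.symm q) := by
    rw [← Measure.volume_eq_prod]
    exact (he.symm e).quasiMeasurePreserving.ae h
  have hsw : MeasurePreserving (Prod.swap : (Fin b → ℝ) × ℝ → ℝ × (Fin b → ℝ))
      ((volume : Measure (Fin b → ℝ)).prod (volume : Measure ℝ))
      ((volume : Measure ℝ).prod (volume : Measure (Fin b → ℝ))) :=
    Measure.measurePreserving_swap
  have h2 : ∀ᵐ q : (Fin b → ℝ) × ℝ ∂((volume : Measure (Fin b → ℝ)).prod (volume : Measure ℝ)),
      p (Fin.snoc q.1 q.2) := by
    filter_upwards [hsw.quasiMeasurePreserving.ae h1] with q hq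
    simpa [he_symm] using hq
  exact Measure.ae_ae_of_ae_prod h2

/-- Integrable on `ℝᵇ⁺¹` ⇒ a.e. fibre `t ↦ G (Fin.snoc x t)` integrable. [folklore] -/
theorem ae_integrable_snoc {G : (Fin (b + 1) → ℝ) → ℝ} (hG : Integrable G) :
    ∀ᵐ x : (Fin b → ℝ), Integrable (fun t : ℝ => G (Fin.snoc x t)) :=
  (integrable_snoc_prod hG).prod_left_ae

/-- Zero-extension of a `ℚ`-semialgebraic function on `s` to any `ℚ`-semialgebraic `S` is
`ℚ`-semialgebraic on `S`. [BCR 1998, Prop. 2.2.6; folklore] -/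
theorem isSemialgebraicFunOn_indicator {s S : Set (Fin b → ℝ)} {f : (Fin b → ℝ) → ℝ}
    (hs : IsSemialgebraic ℚ s) (hS : IsSemialgebraic ℚ S) (hf : IsSemialgebraicFunOn ℚ s f) :
    IsSemialgebraicFunOn ℚ S (s.indicator f) := by
  have h1 : IsSemialgebraicFunOn ℚ (S ∩ s) f := hf.mono inter_subset_right (hS.inter hs)
  have h0 : IsSemialgebraicFunOn ℚ (S \ s) (fun _ => ((0 : ℚ) : ℝ)) :=
    isSemialgebraicFunOn_ratCast (hS.diff hs) 0
  rw [isSemialgebraicFunOn_iff] at h1 h0 ⊢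
  convert h1.union h0 using 1
  ext z
  simp only [mem_setOf_eq, mem_inter_iff, Set.mem_sdiff, mem_union, Rat.cast_zero]
  by_cases h : Fin.init z ∈ s
  · simp [h]
  · simp [h]

end GlueTransport

namespace RTerm

variable {b : ℕ}

/-- The **glued term** of two regularised terms: union of the bases, every datum extended by zero. -/
def glue (T₁ T₂ : RTerm b) : RTerm b where
  domain := T₁.domain ∪ T₂.domain
  h₀ := T₁.domain.indicator T₁.h₀ + T₂.domain.indicator T₂.h₀
  k := T₁.k + T₂.k
  h := Fin.append (fun i => T₁.domain.indicator (T₁.h i)) (fun j => T₂.domain.indicator (T₂.h j))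
  κ := Fin.append (fun i => T₁.domain.indicator (T₁.κ i)) (fun j => T₂.domain.indicator (T₂.κ j))
  M := Fin.append T₁.M T₂.M
  e := Fin.append T₁.e T₂.e

section GlueLemmas

variable (T₁ T₂ : RTerm b)

/-- `glue_domain`: auxiliary theorem of the `RegFoldingDegOne` (stmt-30571) development — see the module docstring; statement and proof verbatim from the lens-3 g9 landing file. -/
@[simp] theorem glue_domain : (glue T₁ T₂).domain = T₁.domain ∪ T₂.domain := rfl
/-- `glue_k`: auxiliary theorem of the `RegFoldingDegOne` (stmt-30571) development — see the module docstring; statement and proof verbatim from the lens-3 g9 landing file. -/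
@[simp] theorem glue_k : (glue T₁ T₂).k = T₁.k + T₂.k := rfl
/-- `glue_h₀`: auxiliary theorem of the `RegFoldingDegOne` (stmt-30571) development — see the module docstring; statement and proof verbatim from the lens-3 g9 landing file. -/
@[simp] theorem glue_h₀ : (glue T₁ T₂).h₀ = T₁.domain.indicator T₁.h₀ + T₂.domain.indicator T₂.h₀ := rfl
/-- `glue_h_left`: auxiliary theorem of the `RegFoldingDegOne` (stmt-30571) development — see the module docstring; statement and proof verbatim from the lens-3 g9 landing file. -/
@[simp] theorem glue_h_left (i : Fin T₁.k) :
    (glue T₁ T₂).h (Fin.castAdd T₂.k i) = T₁.domain.indicator (T₁.h i) := by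
  simp [glue]
/-- `glue_h_right`: auxiliary theorem of the `RegFoldingDegOne` (stmt-30571) development — see the module docstring; statement and proof verbatim from the lens-3 g9 landing file. -/
@[simp] theorem glue_h_right (j : Fin T₂.k) :
    (glue T₁ T₂).h (Fin.natAdd T₁.k j) = T₂.domain.indicator (T₂.h j) := by
  simp [glue]
/-- `glue_κ_left`: auxiliary theorem of the `RegFoldingDegOne` (stmt-30571) development — see the module docstring; statement and proof verbatim from the lens-3 g9 landing file. -/
@[simp] theorem glue_κ_left (i : Fin T₁.k) :
    (glue T₁ T₂).κ (Fin.castAdd T₂.k i) = T₁.domain.indicator (T₁.κ i) := by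
  simp [glue]
/-- `glue_κ_right`: auxiliary theorem of the `RegFoldingDegOne` (stmt-30571) development — see the module docstring; statement and proof verbatim from the lens-3 g9 landing file. -/
@[simp] theorem glue_κ_right (j : Fin T₂.k) :
    (glue T₁ T₂).κ (Fin.natAdd T₁.k j) = T₂.domain.indicator (T₂.κ j) := by
  simp [glue]
/-- `glue_M_left`: auxiliary theorem of the `RegFoldingDegOne` (stmt-30571) development — see the module docstring; statement and proof verbatim from the lens-3 g9 landing file. -/
@[simp] theorem glue_M_left (i : Fin T₁.k) : (glue T₁ T₂).M (Fin.castAdd T₂.k i) = T₁.M i := by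
  simp [glue]
/-- `glue_M_right`: auxiliary theorem of the `RegFoldingDegOne` (stmt-30571) development — see the module docstring; statement and proof verbatim from the lens-3 g9 landing file. -/
@[simp] theorem glue_M_right (j : Fin T₂.k) : (glue T₁ T₂).M (Fin.natAdd T₁.k j) = T₂.M j := by
  simp [glue]
/-- `glue_e_left`: auxiliary theorem of the `RegFoldingDegOne` (stmt-30571) development — see the module docstring; statement and proof verbatim from the lens-3 g9 landing file. -/
@[simp] theorem glue_e_left (i : Fin T₁.k) : (glue T₁ T₂).e (Fin.castAdd T₂.k i) = T₁.e i := by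
  simp [glue]
/-- `glue_e_right`: auxiliary theorem of the `RegFoldingDegOne` (stmt-30571) development — see the module docstring; statement and proof verbatim from the lens-3 g9 landing file. -/
@[simp] theorem glue_e_right (j : Fin T₂.k) : (glue T₁ T₂).e (Fin.natAdd T₁.k j) = T₂.e j := by
  simp [glue]

/-- Left monomials of the glued term = slab-zero-extensions of the monomials of `T₁`. -/
theorem glue_monomialFun_left (i : Fin T₁.k) :
    (glue T₁ T₂).monomialFun (Fin.castAdd T₂.k i) =
      {z : Fin (b + 1) → ℝ | Fin.init z ∈ T₁.domain}.indicator (T₁.monomialFun i) := by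
  funext z
  simp only [monomialFun, glue_h_left, glue_κ_left, glue_M_left, glue_e_left]
  by_cases hz : Fin.init z ∈ T₁.domain
  · have hz' : z ∈ {w : Fin (b + 1) → ℝ | Fin.init w ∈ T₁.domain} := hz
    rw [indicator_of_mem hz, indicator_of_mem hz, indicator_of_mem hz']
    rfl
  · have hz' : z ∉ {w : Fin (b + 1) → ℝ | Fin.init w ∈ T₁.domain} := hz
    rw [indicator_of_notMem hz, indicator_of_notMem hz', zero_mul]

/-- `glue_monomialFun_right`: auxiliary theorem of the `RegFoldingDegOne` (stmt-30571) development — see the module docstring; statement and proof verbatim from the lens-3 g9 landing file. -/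
theorem glue_monomialFun_right (j : Fin T₂.k) :
    (glue T₁ T₂).monomialFun (Fin.natAdd T₁.k j) =
      {z : Fin (b + 1) → ℝ | Fin.init z ∈ T₂.domain}.indicator (T₂.monomialFun j) := by
  funext z
  simp only [monomialFun, glue_h_right, glue_κ_right, glue_M_right, glue_e_right]
  by_cases hz : Fin.init z ∈ T₂.domain
  · have hz' : z ∈ {w : Fin (b + 1) → ℝ | Fin.init w ∈ T₂.domain} := hz
    rw [indicator_of_mem hz, indicator_of_mem hz, indicator_of_mem hz']
    rfl
  · have hz' : z ∉ {w : Fin (b + 1) → ℝ | Fin.init w ∈ T₂.domain} := hz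
    rw [indicator_of_notMem hz, indicator_of_notMem hz', zero_mul]

/-- `glue_base_left`: auxiliary theorem of the `RegFoldingDegOne` (stmt-30571) development — see the module docstring; statement and proof verbatim from the lens-3 g9 landing file. -/
theorem glue_base_left (i : Fin T₁.k) :
    (fun x => (glue T₁ T₂).h (Fin.castAdd T₂.k i) x *
        ell ((glue T₁ T₂).M (Fin.castAdd T₂.k i)) ((glue T₁ T₂).e (Fin.castAdd T₂.k i))
          ((glue T₁ T₂).κ (Fin.castAdd T₂.k i) x)) =
      T₁.domain.indicator (fun x => T₁.h i x * ell (T₁.M i) (T₁.e i) (T₁.κ i x)) := by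
  funext x
  simp only [glue_h_left, glue_κ_left, glue_M_left, glue_e_left]
  by_cases hx : x ∈ T₁.domain
  · rw [indicator_of_mem hx, indicator_of_mem hx, indicator_of_mem hx]
  · rw [indicator_of_notMem hx, indicator_of_notMem hx, indicator_of_notMem hx, zero_mul]

/-- `glue_base_right`: auxiliary theorem of the `RegFoldingDegOne` (stmt-30571) development — see the module docstring; statement and proof verbatim from the lens-3 g9 landing file. -/
theorem glue_base_right (j : Fin T₂.k) :
    (fun x => (glue T₁ T₂).h (Fin.natAdd T₁.k j) x *
        ell ((glue T₁ T₂).M (Fin.natAdd T₁.k j)) ((glue T₁ T₂).e (Fin.natAdd T₁.k j))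
          ((glue T₁ T₂).κ (Fin.natAdd T₁.k j) x)) =
      T₂.domain.indicator (fun x => T₂.h j x * ell (T₂.M j) (T₂.e j) (T₂.κ j x)) := by
  funext x
  simp only [glue_h_right, glue_κ_right, glue_M_right, glue_e_right]
  by_cases hx : x ∈ T₂.domain
  · rw [indicator_of_mem hx, indicator_of_mem hx, indicator_of_mem hx]
  · rw [indicator_of_notMem hx, indicator_of_notMem hx, indicator_of_notMem hx, zero_mul]

/-- `cyl_inter_slab_left`: auxiliary theorem of the `RegFoldingDegOne` (stmt-30571) development — see the module docstring; statement and proof verbatim from the lens-3 g9 landing file. -/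
theorem cyl_inter_slab_left :
    cyl (T₁.domain ∪ T₂.domain) ∩ {z : Fin (b + 1) → ℝ | Fin.init z ∈ T₁.domain} = cyl T₁.domain := by
  ext z
  simp only [cyl, mem_inter_iff, mem_setOf_eq, mem_union]
  tauto

/-- `cyl_inter_slab_right`: auxiliary theorem of the `RegFoldingDegOne` (stmt-30571) development — see the module docstring; statement and proof verbatim from the lens-3 g9 landing file. -/
theorem cyl_inter_slab_right :
    cyl (T₁.domain ∪ T₂.domain) ∩ {z : Fin (b + 1) → ℝ | Fin.init z ∈ T₂.domain} = cyl T₂.domain := by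
  ext z
  simp only [cyl, mem_inter_iff, mem_setOf_eq, mem_union]
  tauto

/-- On the glued cylinder the left monomial agrees with the cylinder-zero-extension of `T₁`'s monomial. -/
theorem eqOn_glue_monomialFun_left (i : Fin T₁.k) :
    EqOn ((cyl T₁.domain).indicator (T₁.monomialFun i))
      ((glue T₁ T₂).monomialFun (Fin.castAdd T₂.k i)) (cyl (T₁.domain ∪ T₂.domain)) := by
  intro z hz
  rw [glue_monomialFun_left, ← cyl_inter_slab_left T₁ T₂, ← Set.indicator_indicator,
    indicator_of_mem hz]

/-- `eqOn_glue_monomialFun_right`: auxiliary theorem of the `RegFoldingDegOne` (stmt-30571) development — see the module docstring; statement and proof verbatim from the lens-3 g9 landing file. -/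
theorem eqOn_glue_monomialFun_right (j : Fin T₂.k) :
    EqOn ((cyl T₂.domain).indicator (T₂.monomialFun j))
      ((glue T₁ T₂).monomialFun (Fin.natAdd T₁.k j)) (cyl (T₁.domain ∪ T₂.domain)) := by
  intro z hz
  rw [glue_monomialFun_right, ← cyl_inter_slab_right T₁ T₂, ← Set.indicator_indicator,
    indicator_of_mem hz]

end GlueLemmas

end RTerm

end RegularisedLogLayer

end Summit.KontsevichZagierPeriods.RootDecompRelativeModAbsolute.Rung30571

end
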